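import Literature.Algebra.EuclideanLattices.LLLProofs
import HarnessLib

/-!
# Enumeration boxes for LLL-reduced bases and sup-norm perturbation of integer rows

Topic `Algebra/EuclideanLattices`. Two groups of elementary, fully PROVED facts (no definition, no
named fact) used when one runs an exact LLL reduction on a *rounded* copy of a real lattice basis and
then enumerates the short lattice vectors by their integer coordinates.

## 1. Gram–Schmidt coordinates of a lattice vector and the enumeration recursion

Let `b : Fin n → E` be a family in a real inner product space, `b*ⱼ := gramSchmidt ℝ b j` (Mathlib),
`μᵢⱼ := gsCoeff b i j = ⟪bᵢ, b*ⱼ⟫ / ‖b*ⱼ‖²` (`Literature.Algebra.EuclideanLattices.LLL`), and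
`v = ∑ᵢ cᵢ bᵢ` with real coefficients `cᵢ`.

* `inner_sum_smul_gramSchmidt`: `⟪v, b*ⱼ⟫ = (∑ᵢ cᵢ μᵢⱼ) ‖b*ⱼ‖²`;
* `abs_sum_mul_gsCoeff_mul_norm_le`: `|∑ᵢ cᵢ μᵢⱼ| ‖b*ⱼ‖ ≤ ‖v‖` (Cauchy–Schwarz);
* `sum_mul_gsCoeff_eq`: if `b*ⱼ ≠ 0` then `∑ᵢ cᵢ μᵢⱼ = cⱼ + ∑_{i>j} cᵢ μᵢⱼ` (`μⱼⱼ = 1`, `μᵢⱼ = 0`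
  for `i < j`, LLL82 (1.2));
* `abs_coeff_le_of_isSizeReduced` (the **enumeration recursion**): if `b` is size-reduced
  (`|μᵢⱼ| ≤ 1/2`, LLL82 (1.4)) and `b*ⱼ ≠ 0`, then
  `|cⱼ| ≤ ‖v‖ / ‖b*ⱼ‖ + ½ ∑_{i>j} |cᵢ|`, so the integer coordinates of the lattice vectors of norm
  `≤ ρ` lie in an explicit box computed downwards from `j = n - 1` (the bound underlying the
  Fincke–Pohst / Kannan enumeration of short vectors);
* `sq_le_two_pow_mul_sq_norm_gramSchmidt`: if `b` is LLL-reduced with `δ = 3/4` and every nonzero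
  integer combination of the `bᵢ` has norm `≥ m ≥ 0` (i.e. `m ≤ λ₁`), then `m² ≤ 2ʲ ‖b*ⱼ‖²`
  (LLL82 (1.7) applied to the lattice vector `b₀`: `m² ≤ ‖b₀‖² ≤ 2ʲ ‖b*ⱼ‖²`).

## 2. Entrywise perturbation of a matrix and the sup norm of `v B`

For real matrices `B, B'` indexed by finite types with `|Bᵢⱼ - B'ᵢⱼ| ≤ δ` and the sup norm on
`m → ℝ`, `n → ℝ` (Mathlib's `Pi` norm):

* `norm_vecMul_sub_vecMul_le`: `‖v B' - v B‖ ≤ |m| δ ‖v‖`;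
* `norm_vecMul_perturb_le` / `norm_vecMul_perturb_ge`: if moreover `μ ‖v‖ ≤ ‖v B‖` for all `v`
  (`μ > 0`, a lower bound for the co-norm of `B`), then
  `‖v B‖ (1 - |m| δ / μ) ≤ ‖v B'‖ ≤ ‖v B‖ (1 + |m| δ / μ)`.

## References

* A. K. Lenstra, H. W. Lenstra Jr., L. Lovász, *Factoring polynomials with rational coefficients*,
  Math. Ann. 261 (1982) 515–534, (1.2), (1.4), Prop. 1.6 (1.7), proof of Prop. 1.11.
  [LenstraLenstraLovasz1982]
* H. Cohen, *A Course in Computational Algebraic Number Theory*, GTM 138 (1993), §2.6.1 and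
  Algorithm 2.7.5 (Fincke–Pohst enumeration). [Cohen1993]

## Design

Pure theorem file. Section 1 is stated for `b : Fin n → E` in an arbitrary real inner product space
(as the facts of `LLL.lean` it uses); Section 2 for `Matrix m n ℝ` over arbitrary `Fintype` index
types. The rank-`3` numerical box `|cᵢ| ≤ 4ρ/m + 2` consumed by the cubic-field infrastructure is
derived problem-side from these lemmas.
-/

noncomputable section

open Finset Module InnerProductSpace
open scoped RealInnerProductSpace

namespace Literature.Algebra.EuclideanLattices

/-! ### 1. Gram–Schmidt coordinates and the enumeration recursion -/

section Coordinates

variable {E : Type*} [NormedAddCommGroup E] [InnerProductSpace ℝ E] {n : ℕ}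

/-- `⟪∑ᵢ cᵢ bᵢ, b*ⱼ⟫ = (∑ᵢ cᵢ μᵢⱼ) ‖b*ⱼ‖²`: the `b*ⱼ`-coordinate of `v = ∑ᵢ cᵢ bᵢ` is `∑ᵢ cᵢ μᵢⱼ`
(from `⟪bᵢ, b*ⱼ⟫ = μᵢⱼ ‖b*ⱼ‖²`, LLL82 (1.2); also valid when `b*ⱼ = 0`). [folklore] -/
theorem inner_sum_smul_gramSchmidt (b : Fin n → E) (c : Fin n → ℝ) (j : Fin n) :
    ⟪∑ i, c i • b i, gramSchmidt ℝ b j⟫_ℝ =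
      (∑ i, c i * gsCoeff b i j) * ‖gramSchmidt ℝ b j‖ ^ 2 := by
  rw [sum_inner, Finset.sum_mul]
  refine Finset.sum_congr rfl fun i _ => ?_
  rw [real_inner_smul_left, mul_assoc, gsCoeff_mul_sq_norm]

/-- Cauchy–Schwarz on the `b*ⱼ`-coordinate: `|∑ᵢ cᵢ μᵢⱼ| ‖b*ⱼ‖ ≤ ‖∑ᵢ cᵢ bᵢ‖` (equivalently, by
orthogonality of the `b*`, `‖v‖² = ∑ⱼ (∑ᵢ cᵢ μᵢⱼ)² ‖b*ⱼ‖²` dominates each summand; LLL82, proof of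
Prop. 1.11). [folklore] -/
theorem abs_sum_mul_gsCoeff_mul_norm_le (b : Fin n → E) (c : Fin n → ℝ) (j : Fin n) :
    |∑ i, c i * gsCoeff b i j| * ‖gramSchmidt ℝ b j‖ ≤ ‖∑ i, c i • b i‖ := by
  by_cases h : gramSchmidt ℝ b j = 0
  · rw [h, norm_zero, mul_zero]
    exact norm_nonneg _
  have hpos : 0 < ‖gramSchmidt ℝ b j‖ := norm_pos_iff.2 h
  have key : |∑ i, c i * gsCoeff b i j| * ‖gramSchmidt ℝ b j‖ ^ 2 ≤
      ‖∑ i, c i • b i‖ * ‖gramSchmidt ℝ b j‖ :=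
    calc |∑ i, c i * gsCoeff b i j| * ‖gramSchmidt ℝ b j‖ ^ 2
        = |⟪∑ i, c i • b i, gramSchmidt ℝ b j⟫_ℝ| := by
          rw [inner_sum_smul_gramSchmidt, abs_mul, abs_pow, abs_norm]
      _ ≤ ‖∑ i, c i • b i‖ * ‖gramSchmidt ℝ b j‖ := abs_real_inner_le_norm _ _
  rw [pow_two, ← mul_assoc] at key
  exact le_of_mul_le_mul_right key hpos

/-- Triangularity of the Gram–Schmidt coefficients (LLL82 (1.2): `μⱼⱼ = 1`, `μᵢⱼ = 0` for `i < j`)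
in the coordinate `∑ᵢ cᵢ μᵢⱼ`: if `b*ⱼ ≠ 0` then `∑ᵢ cᵢ μᵢⱼ = cⱼ + ∑_{i>j} cᵢ μᵢⱼ`.
[cite: LenstraLenstraLovasz1982, (1.2)] -/
theorem sum_mul_gsCoeff_eq (b : Fin n → E) (c : Fin n → ℝ) {j : Fin n}
    (h : gramSchmidt ℝ b j ≠ 0) :
    ∑ i, c i * gsCoeff b i j = c j + ∑ i ∈ Ioi j, c i * gsCoeff b i j := by
  rw [← Finset.sum_add_sum_compl (Ioi j), add_comm]
  congr 1
  have hc : (Ioi j)ᶜ = Iic j := by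
    ext i
    simp
  rw [hc, Finset.sum_eq_single_of_mem j (mem_Iic.2 le_rfl)]
  · rw [gsCoeff_self_holds b j h, mul_one]
  · intro i hi hij
    rw [gsCoeff_eq_zero_of_lt_holds b (lt_of_le_of_ne (mem_Iic.1 hi) hij), mul_zero]

/-- **Enumeration recursion.** If `b` is size-reduced (`|μᵢⱼ| ≤ 1/2` for `j < i`, LLL82 (1.4)) and
`b*ⱼ ≠ 0`, then every `v = ∑ᵢ cᵢ bᵢ` satisfies `|cⱼ| ≤ ‖v‖ / ‖b*ⱼ‖ + ½ ∑_{i>j} |cᵢ|`: indeed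
`|cⱼ + ∑_{i>j} cᵢ μᵢⱼ| ‖b*ⱼ‖ ≤ ‖v‖` and `|∑_{i>j} cᵢ μᵢⱼ| ≤ ½ ∑_{i>j} |cᵢ|`. Run downwards from
`j = n - 1`, this confines the coordinates of the vectors of norm `≤ ρ` to an explicit box (the
bound behind the Fincke–Pohst / Kannan enumeration of short lattice vectors). [folklore] -/
theorem abs_coeff_le_of_isSizeReduced {b : Fin n → E} (hb : IsSizeReduced b) (c : Fin n → ℝ)
    {j : Fin n} (h : gramSchmidt ℝ b j ≠ 0) :
    |c j| ≤ ‖∑ i, c i • b i‖ / ‖gramSchmidt ℝ b j‖ + 1 / 2 * ∑ i ∈ Ioi j, |c i| := by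
  have hpos : 0 < ‖gramSchmidt ℝ b j‖ := norm_pos_iff.2 h
  have h1 : |c j + ∑ i ∈ Ioi j, c i * gsCoeff b i j| ≤ ‖∑ i, c i • b i‖ / ‖gramSchmidt ℝ b j‖ := by
    rw [le_div_iff₀ hpos, ← sum_mul_gsCoeff_eq b c h]
    exact abs_sum_mul_gsCoeff_mul_norm_le b c j
  have h2 : |∑ i ∈ Ioi j, c i * gsCoeff b i j| ≤ 1 / 2 * ∑ i ∈ Ioi j, |c i| :=
    calc |∑ i ∈ Ioi j, c i * gsCoeff b i j| ≤ ∑ i ∈ Ioi j, |c i * gsCoeff b i j| :=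
          abs_sum_le_sum_abs _ _
      _ ≤ ∑ i ∈ Ioi j, 1 / 2 * |c i| := by
          refine sum_le_sum fun i hi => ?_
          rw [abs_mul, mul_comm]
          exact mul_le_mul_of_nonneg_right (hb i j (mem_Ioi.1 hi)) (abs_nonneg _)
      _ = 1 / 2 * ∑ i ∈ Ioi j, |c i| := by rw [Finset.mul_sum]
  calc |c j| = |(c j + ∑ i ∈ Ioi j, c i * gsCoeff b i j) - ∑ i ∈ Ioi j, c i * gsCoeff b i j| := by
        rw [add_sub_cancel_right]
    _ ≤ |c j + ∑ i ∈ Ioi j, c i * gsCoeff b i j| + |∑ i ∈ Ioi j, c i * gsCoeff b i j| :=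
        abs_sub _ _
    _ ≤ _ := add_le_add h1 h2

/-- The basis vector `bⱼ` is the integer combination with coefficient vector `Pi.single j 1`.
[folklore] -/
theorem sum_cast_single_smul (b : Fin n → E) (j : Fin n) :
    ∑ i, (((Pi.single j (1 : ℤ) : Fin n → ℤ) i : ℤ) : ℝ) • b i = b j := by
  rw [Finset.sum_eq_single j]
  · simp
  · intro i _ hij
    simp [hij]
  · exact fun hj => (hj (mem_univ j)).elim

/-- **Gram–Schmidt lengths versus the first minimum.** If `b : Fin n → E` is LLL-reduced with
`δ = 3/4` and every nonzero integer combination of the `bᵢ` has norm at least `m ≥ 0` (that is,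
`m ≤ λ₁` of the lattice `∑ ℤ bᵢ`), then `m² ≤ 2ʲ ‖b*ⱼ‖²` for every `j`: `b₀` is such a combination
and `‖b₀‖² ≤ 2ʲ ‖b*ⱼ‖²` by LLL82 (1.7). [cite: LenstraLenstraLovasz1982, Prop. 1.6 (1.7)] -/
theorem sq_le_two_pow_mul_sq_norm_gramSchmidt {b : Fin n → E} (h : IsLLLReduced (3 / 4) b)
    {m : ℝ} (hm : 0 ≤ m) (hmin : ∀ c : Fin n → ℤ, c ≠ 0 → m ≤ ‖∑ i, (c i : ℝ) • b i‖)
    (j : Fin n) :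
    m ^ 2 ≤ 2 ^ (j : ℕ) * ‖gramSchmidt ℝ b j‖ ^ 2 := by
  have hn : 0 < n := j.pos
  have h0 : m ≤ ‖b ⟨0, hn⟩‖ := by
    have hne : (Pi.single (⟨0, hn⟩ : Fin n) (1 : ℤ) : Fin n → ℤ) ≠ 0 := by
      intro h'
      have := congrFun h' ⟨0, hn⟩
      simp at this
    have := hmin _ hne
    rwa [sum_cast_single_smul] at this
  calc m ^ 2 ≤ ‖b ⟨0, hn⟩‖ ^ 2 := pow_le_pow_left₀ hm h0 2
    _ ≤ 2 ^ (j : ℕ) * ‖gramSchmidt ℝ b j‖ ^ 2 :=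
        IsLLLReduced.sq_norm_zero_le_two_pow_mul_holds h j hn

end Coordinates

/-! ### 2. Entrywise perturbation of a matrix and the sup norm of `v B` -/

section Perturbation

variable {m n : Type*} [Fintype m] [Fintype n]

/-- If `|Bᵢⱼ - B'ᵢⱼ| ≤ δ` for all `i, j`, then `‖v B' - v B‖ ≤ |m| δ ‖v‖` in the sup norms: each
entry of `v (B' - B)` is a sum of `|m|` terms `vᵢ (B'ᵢⱼ - Bᵢⱼ)` of size `≤ ‖v‖ δ`. [folklore] -/
theorem norm_vecMul_sub_vecMul_le (B B' : Matrix m n ℝ) {δ : ℝ} (hδ : 0 ≤ δ)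
    (hBB' : ∀ i j, |B i j - B' i j| ≤ δ) (v : m → ℝ) :
    ‖Matrix.vecMul v B' - Matrix.vecMul v B‖ ≤ Fintype.card m * δ * ‖v‖ := by
  rw [pi_norm_le_iff_of_nonneg (by positivity)]
  intro j
  rw [← Matrix.vecMul_sub, Real.norm_eq_abs, Matrix.vecMul_apply_eq_sum]
  calc |∑ i, v i * (B' - B) i j| ≤ ∑ i, |v i * (B' - B) i j| := abs_sum_le_sum_abs _ _
    _ ≤ ∑ _i : m, δ * ‖v‖ := by
        refine sum_le_sum fun i _ => ?_
        rw [abs_mul, Matrix.sub_apply, abs_sub_comm, mul_comm]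
        exact mul_le_mul (hBB' i j) (by simpa using norm_le_pi_norm v i) (abs_nonneg _) hδ
    _ = Fintype.card m * δ * ‖v‖ := by
        rw [sum_const, card_univ, nsmul_eq_mul, mul_assoc]

/-- **Upper perturbation bound.** If `|Bᵢⱼ - B'ᵢⱼ| ≤ δ` and `μ ‖v‖ ≤ ‖v B‖` for all `v` with
`μ > 0` (sup norms), then `‖v B'‖ ≤ ‖v B‖ (1 + |m| δ / μ)`:
`‖v B'‖ ≤ ‖v B‖ + |m| δ ‖v‖ ≤ ‖v B‖ + |m| δ ‖v B‖ / μ`. [folklore] -/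
theorem norm_vecMul_perturb_le (B B' : Matrix m n ℝ) {δ μ : ℝ} (hδ : 0 ≤ δ) (hμ : 0 < μ)
    (hBB' : ∀ i j, |B i j - B' i j| ≤ δ) (hB : ∀ v : m → ℝ, μ * ‖v‖ ≤ ‖Matrix.vecMul v B‖)
    (v : m → ℝ) :
    ‖Matrix.vecMul v B'‖ ≤ ‖Matrix.vecMul v B‖ * (1 + Fintype.card m * δ / μ) := by
  have h1 := norm_vecMul_sub_vecMul_le B B' hδ hBB' v
  have h2 : ‖v‖ ≤ ‖Matrix.vecMul v B‖ / μ := by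
    rw [le_div_iff₀ hμ, mul_comm]
    exact hB v
  have h3 : (Fintype.card m : ℝ) * δ * ‖v‖ ≤ Fintype.card m * δ * (‖Matrix.vecMul v B‖ / μ) :=
    mul_le_mul_of_nonneg_left h2 (by positivity)
  calc ‖Matrix.vecMul v B'‖
      = ‖Matrix.vecMul v B + (Matrix.vecMul v B' - Matrix.vecMul v B)‖ := by
        rw [add_sub_cancel]
    _ ≤ ‖Matrix.vecMul v B‖ + ‖Matrix.vecMul v B' - Matrix.vecMul v B‖ := norm_add_le _ _
    _ ≤ ‖Matrix.vecMul v B‖ + Fintype.card m * δ * (‖Matrix.vecMul v B‖ / μ) :=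
        add_le_add le_rfl (h1.trans h3)
    _ = ‖Matrix.vecMul v B‖ * (1 + Fintype.card m * δ / μ) := by ring

/-- **Lower perturbation bound.** Under the same hypotheses,
`‖v B‖ (1 - |m| δ / μ) ≤ ‖v B'‖`: `‖v B'‖ ≥ ‖v B‖ - |m| δ ‖v‖ ≥ ‖v B‖ - |m| δ ‖v B‖ / μ`.
[folklore] -/
theorem norm_vecMul_perturb_ge (B B' : Matrix m n ℝ) {δ μ : ℝ} (hδ : 0 ≤ δ) (hμ : 0 < μ)
    (hBB' : ∀ i j, |B i j - B' i j| ≤ δ) (hB : ∀ v : m → ℝ, μ * ‖v‖ ≤ ‖Matrix.vecMul v B‖)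
    (v : m → ℝ) :
    ‖Matrix.vecMul v B‖ * (1 - Fintype.card m * δ / μ) ≤ ‖Matrix.vecMul v B'‖ := by
  have h1 := norm_vecMul_sub_vecMul_le B B' hδ hBB' v
  have h2 : ‖v‖ ≤ ‖Matrix.vecMul v B‖ / μ := by
    rw [le_div_iff₀ hμ, mul_comm]
    exact hB v
  have h3 : (Fintype.card m : ℝ) * δ * ‖v‖ ≤ Fintype.card m * δ * (‖Matrix.vecMul v B‖ / μ) :=
    mul_le_mul_of_nonneg_left h2 (by positivity)
  have h4 : ‖Matrix.vecMul v B‖ - ‖Matrix.vecMul v B' - Matrix.vecMul v B‖ ≤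
      ‖Matrix.vecMul v B'‖ := by
    rw [sub_le_iff_le_add, norm_sub_rev]
    exact norm_le_insert' _ _
  calc ‖Matrix.vecMul v B‖ * (1 - Fintype.card m * δ / μ)
      = ‖Matrix.vecMul v B‖ - Fintype.card m * δ * (‖Matrix.vecMul v B‖ / μ) := by ring
    _ ≤ ‖Matrix.vecMul v B‖ - ‖Matrix.vecMul v B' - Matrix.vecMul v B‖ := by
        linarith
    _ ≤ ‖Matrix.vecMul v B'‖ := h4

end Perturbation

end Literature.Algebra.EuclideanLattices

end
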